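/-
Copyright (c) 2026 the pub-hodgecm-mathlib formalisation cell (harness21).  Prover seat hodgecm-mathlib-B-p08 (g41): unit U4_Rows of the «(D-RAM) FOUR-FRAME» road,
TIER-2 file paying the three §1 (iv-0) PROFILE rows `stub_U4_pieceProps_transvPlus ∕ _transvMinus ∕ _reg : PiecePropsWild mstarFn (fun _ : Fin 1 => piece…)` of
`Cruxes/H413/Lines/F0_P3c_DyRamFourFrame_U4_Rows.lean` BY NAME; 2026-09-03.
-/
import Summits.HodgeConjecture.HodgeConjecture.Theorems.F0P3cDyRamProfilePiecesProps   -- ★ p854742 (B-p08 (g41)): `isLocSmooth_pieceTransvPlus ∕ Minus ∕ Reg`, `pieces_conj_eq`, `indicator_profile_level_mul_eq`, `uniformizer_facts`; brings ★ p854732 level-class lemmas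
import Summits.HodgeConjecture.HodgeConjecture.Theorems.F0P3cDyRamDOfPlaceOfDatum      -- ★ p854662 (LH4-p02 (g12)): `dOfPlace_eq_of_isRamifiedQuadraticDatum`
import Summits.HodgeConjecture.HodgeConjecture.Theorems.F0P3cDyRamWildPlaceDatum       -- ★ #12 (F0P3a-p06): `exists_isRamifiedQuadraticDatum_of_placesOver`
import HarnessLib

/-!
# Crux `H413`, line LH4 «(D-RAM) FOUR-FRAME» road — unit U4_Rows (iv-0), TIER 2: the piece properties of the three PROFILE pieces `f_{T+}, f_{T−}, f_reg`
# AT THE SHARP LEVEL `m* = mstarFn` (pays `U4_Rows.stub_U4_pieceProps_transvPlus ∕ _transvMinus ∕ _reg` BY NAME)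

Cell `hodgecm-mathlib` (D-0151), FLOOR 0, crux item H413 = `stmt-HodgeConjecture-24833`, route of record `HCCMUnconditional`; squad F0∕P3c∕LH4 (req618), director s1808;
tier-1 module `Cruxes/H413/Lines/F0_P3c_DyRamFourFrame_U4_Rows.lean` ED. 1 (b2ef357bfcbb4be0; dealer LH4-plan (g10)), §1 rows (dealer HELD-BY v1: EMIT — taken by this seat
21:13Z).  THEOREMS ONLY (no `def`, no instance, no notation, no `sorry`, default heartbeats); lane `--supports stmt-HodgeConjecture-24833 --as helper` (count-neutral).
Model: ★ p854783 `Theorems/F0P3cDyRamPiecePropsUnit0.lean` (F0P3-p01 (g30), the `1_K` row).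

WHAT IS PROVED.  `piecePropsWild_transvPlus : PiecePropsWild mstarFn (fun _ : Fin 1 => pieceTransvPlus)`, `piecePropsWild_transvMinus : PiecePropsWild mstarFn
(fun _ : Fin 1 => pieceTransvMinus)`, `piecePropsWild_reg : PiecePropsWild mstarFn (fun _ : Fin 1 => pieceReg)` — each stub's text TOKEN FOR TOKEN: at every wild ramified
non-split place (binders `hw`, `_he`, `_h2`, uniformiser `ϖ`), the piece is (1) `IsLocSmooth` and (2) `tsupport ⊆ K` — ★ p854742 `isLocSmooth_piece…`; (3) `Ad K`-invariant —
★ p854742 `pieces_conj_eq`; (4) LEFT-INVARIANT under the level-`m*` congruence set `{u | ι_w(u) ≡ 1 mod ϖ^{m*}·M₃(𝒪_w)}`, `m* = mstarFn L v w` — ★ p854742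
`indicator_profile_level_mul_eq` at `n := m*`, whose side conditions `1 ≤ m*`, `d % 2 + 1 ≤ m*` (the shell `NearTransvShell ϖ (d % 2) m*` and the label are class functions of
`ι u − 1` modulo `ϖ^{m*}` as soon as `d % 2 + 1 ≤ m*`, ★ p854732 `nearTransvShell_add_iff ∕ labelPlus_add_iff ∕ inLevel_mul_self_add_iff`) hold because `m* = d % 2 + 2d − 1`
(★ №3 `mstarOfRecord`) and `1 ≤ d = dOfPlace L v w` at a ramified non-split place (★ `exists_isRamifiedQuadraticDatum_of_placesOver` + ★ p854662
`dOfPlace_eq_of_isRamifiedQuadraticDatum`) — `one_le_dOfPlace`, `mstarFn_bounds`.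
* §1 `one_le_dOfPlace`, `mstarFn_bounds`; §2 `pieceTransvPlus_level_mul_eq ∕ pieceTransvMinus_level_mul_eq ∕ pieceReg_level_mul_eq` (clause 4 at `m*`);
  §3 the three heads.

HONEST LABEL.  Count-neutral; the verdict of record for (D-RAM) stays PRINT [LanglandsShelstad1989 Thm. p. 484 ∕ Rogawski1990 Prop. 4.9.1 (a)] ∕ XL; `HC_CM` is proved only
modulo the 7 printed citations (2 remaining: hLiu418 = `stmt-HodgeConjecture-24832`, h413 = `stmt-HodgeConjecture-24833`) until rung 0 closes.

## References
* [Kottwitz1986BaseChangeUnits] R. E. Kottwitz, *Base change for unit elements of Hecke algebras*, Compositio Math. 60 (1986), §3.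
* [Rogawski1990] J. D. Rogawski, *Automorphic Representations of Unitary Groups in Three Variables*, Ann. of Math. Stud. 123 (1990), §1.6 p. 6, §4.9 p. 54.
* [BernsteinZelevinsky1976] I. N. Bernstein, A. V. Zelevinsky, *Representations of the group GL(n,F) where F is a non-archimedean local field*, Russian Math.
  Surveys 31:3 (1976), §1.1.
* [Serre1979] J.-P. Serre, *Local Fields*, GTM 67 (1979), Ch. IV §1 Prop. 4.
-/

noncomputable section

namespace Summit.HodgeConjecture.HodgeConjecture.Cruxes.H413.F0P3cDyRamPiecePropsProfiles

open MeasureTheory Measure NumberField IsDedekindDomain Topology Filter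
open Literature.NumberTheory.Automorphic Literature.NumberTheory.Automorphic.UnitaryGroup Literature.NumberTheory.Automorphic.IntegralReduction
open Literature.NumberTheory.Automorphic.UnitaryLatticeTree Literature.NumberTheory.Automorphic.HermitianLattice
open Literature.NumberTheory.Rogawski1990 Literature.NumberTheory.GaloisRepresentations
open Literature.NumberTheory.Automorphic.UnitaryThreeFourFrame
open Summit.HodgeConjecture.HodgeConjecture.Cruxes.H413.F0P3cDyRamFourFramePieces
open Summit.HodgeConjecture.HodgeConjecture.Cruxes.H413.F0P3cDyRamProfileLevelClass
open Summit.HodgeConjecture.HodgeConjecture.Cruxes.H413.F0P3cDyRamProfilePiecesProps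
open Summit.HodgeConjecture.HodgeConjecture.Cruxes.H413.F0P3cDyRamDOfPlaceOfDatum
open Summit.HodgeConjecture.HodgeConjecture.Cruxes.H413.F0P3cDyRamWildPlaceDatum
open scoped Valued WithZero Matrix MatrixGroups Classical

section Place

variable (L : Type) [Field L] [NumberField L] [IsCMField L] {v : HeightOneSpectrum (𝓞 ↥(maximalRealSubfield L))}
  (w : UnitaryGroup.PlacesOver L v) (hw : IsCMField.complexConj L • w.1 = w.1)

/-! ## §1  `1 ≤ d` and the bounds on `m* = d % 2 + 2d − 1` at a ramified non-split place -/

include hw in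
/-- **`1 ≤ dOfPlace L v w`** at a ramified (`e(w|v) ≠ 1`) non-split (`c • w = w`) CM place: a ramified quadratic datum `(σ_w, ϖ, d, t)` exists there
(★ `exists_isRamifiedQuadraticDatum_of_placesOver`, `1 ≤ d` being one of its clauses) and `dOfPlace L v w = d` (★ p854662). [cite: Serre1979, Ch. IV §1 Prop. 4] -/
theorem one_le_dOfPlace (he : v.asIdeal.ramificationIdx' w.1.asIdeal ≠ 1) {ϖ : w.1.adicCompletion L} (hϖ : Valued.v ϖ = WithZero.exp (-1 : ℤ)) :
    1 ≤ dOfPlace L v w := by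
  obtain ⟨d, t, hD⟩ := exists_isRamifiedQuadraticDatum_of_placesOver L w hw he ϖ hϖ
  rw [dOfPlace_eq_of_isRamifiedQuadraticDatum L w hw he hD]
  exact hD.2.2.2.2.2.1

include hw in
/-- **`1 ≤ m*` and `d % 2 + 1 ≤ m*`** for `m* = mstarFn L v w = d % 2 + 2d − 1`, `d = dOfPlace L v w ≥ 1`. [cite: Serre1979, Ch. IV §1 Prop. 4] -/
theorem mstarFn_bounds (he : v.asIdeal.ramificationIdx' w.1.asIdeal ≠ 1) {ϖ : w.1.adicCompletion L} (hϖ : Valued.v ϖ = WithZero.exp (-1 : ℤ)) :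
    1 ≤ mstarFn L v w ∧ dOfPlace L v w % 2 + 1 ≤ mstarFn L v w := by
  have h1 := one_le_dOfPlace L w hw he hϖ
  have h2 := Nat.mod_lt (dOfPlace L v w) (show 0 < 2 by norm_num)
  simp only [mstarFn, mstarOfRecord]
  omega

/-! ## §2  Clause 4 at the sharp level `m*`: left-invariance under `ι_w(U) ≡ 1 (mod ϖ^{m*})` -/

include hw in
/-- **`f_{T+}(U·x) = f_{T+}(x)` for `ι_w(U) ≡ 1 (mod ϖ^{m*}·M₃(𝒪_w))`** — ★ p854742 `indicator_profile_level_mul_eq` at `n = m*` (`1 ≤ m*`, `d % 2 + 1 ≤ m*`: the shell and the label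
of `ι u − 1` are class functions modulo `ϖ^{m*}M₃(𝒪)`, ★ p854732). [cite: Kottwitz1986BaseChangeUnits, §3] [cite: BernsteinZelevinsky1976, §1.1] -/
theorem pieceTransvPlus_level_mul_eq (he : v.asIdeal.ramificationIdx' w.1.asIdeal ≠ 1) {ϖ : w.1.adicCompletion L} (hϖ : Valued.v ϖ = WithZero.exp (-1 : ℤ))
    (U : ((UnitaryGroup.cmDatum L 3 (Matrix.of fun i j : Fin 3 => if i.val + j.val + 1 = 3 then (1 : L) else 0)).Local v))
    (hU : ∀ a b, Valued.v ((ϖ ^ (mstarFn L v w))⁻¹ *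
      (((((localNonsplitEquiv (IsCMField.complexConj L) (Matrix.of fun i j : Fin 3 => if i.val + j.val + 1 = 3 then (1 : L) else 0) (IsCMField.complexConj_ne_one L) w hw U :
        ↥(unitaryGroupOfForm (galAdicCompletionMap (L := L) (IsCMField.complexConj L) hw) (placeForm (Matrix.of fun i j : Fin 3 => if i.val + j.val + 1 = 3 then (1 : L) else 0) w.1))) : GL (Fin 3) (w.1.adicCompletion L)) : Matrix (Fin 3) (Fin 3) (w.1.adicCompletion L))) a b - (1 : Matrix (Fin 3) (Fin 3) (w.1.adicCompletion L)) a b)) ≤ 1) (x : ((UnitaryGroup.cmDatum L 3 (Matrix.of fun i j : Fin 3 => if i.val + j.val + 1 = 3 then (1 : L) else 0)).Local v)) :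
    pieceTransvPlus L v w hw ϖ (U * x) = pieceTransvPlus L v w hw ϖ x := by
  obtain ⟨hϖ0, hϖ1, hϖ1'⟩ := uniformizer_facts L w hϖ
  obtain ⟨hm1, hℓ⟩ := mstarFn_bounds L w hw he hϖ
  have hvσ : ∀ a : w.1.adicCompletion L, Valued.v ((galAdicCompletionMap (L := L) (IsCMField.complexConj L) hw) a) = Valued.v a := fun a => valued_galAdicCompletionMap (L := L) (IsCMField.complexConj L) hw a
  simp only [pieceTransvPlus, wMatrix]
  exact indicator_profile_level_mul_eq L w hw
    (fun X => NearTransvShell ϖ (dOfPlace L v w % 2) (mstarFn L v w) X ∧ LabelPlus (galAdicCompletionMap (L := L) (IsCMField.complexConj L) hw) ϖ (dOfPlace L v w) (mstarFn L v w) X)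
    hϖ0 hϖ1 hm1 (fun X D hX hD => and_congr (nearTransvShell_add_iff hϖ0 hϖ1' hℓ le_rfl hX hD) (labelPlus_add_iff hvσ hϖ le_rfl _ X hD)) U
    (fun a b => by simpa only [Matrix.smul_apply, Matrix.sub_apply, smul_eq_mul] using hU a b) x

include hw in
/-- **`f_{T−}(U·x) = f_{T−}(x)` for `ι_w(U) ≡ 1 (mod ϖ^{m*}·M₃(𝒪_w))`** (label negated). [cite: Kottwitz1986BaseChangeUnits, §3] [cite: BernsteinZelevinsky1976, §1.1] -/
theorem pieceTransvMinus_level_mul_eq (he : v.asIdeal.ramificationIdx' w.1.asIdeal ≠ 1) {ϖ : w.1.adicCompletion L} (hϖ : Valued.v ϖ = WithZero.exp (-1 : ℤ))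
    (U : ((UnitaryGroup.cmDatum L 3 (Matrix.of fun i j : Fin 3 => if i.val + j.val + 1 = 3 then (1 : L) else 0)).Local v))
    (hU : ∀ a b, Valued.v ((ϖ ^ (mstarFn L v w))⁻¹ *
      (((((localNonsplitEquiv (IsCMField.complexConj L) (Matrix.of fun i j : Fin 3 => if i.val + j.val + 1 = 3 then (1 : L) else 0) (IsCMField.complexConj_ne_one L) w hw U :
        ↥(unitaryGroupOfForm (galAdicCompletionMap (L := L) (IsCMField.complexConj L) hw) (placeForm (Matrix.of fun i j : Fin 3 => if i.val + j.val + 1 = 3 then (1 : L) else 0) w.1))) : GL (Fin 3) (w.1.adicCompletion L)) : Matrix (Fin 3) (Fin 3) (w.1.adicCompletion L))) a b - (1 : Matrix (Fin 3) (Fin 3) (w.1.adicCompletion L)) a b)) ≤ 1) (x : ((UnitaryGroup.cmDatum L 3 (Matrix.of fun i j : Fin 3 => if i.val + j.val + 1 = 3 then (1 : L) else 0)).Local v)) :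
    pieceTransvMinus L v w hw ϖ (U * x) = pieceTransvMinus L v w hw ϖ x := by
  obtain ⟨hϖ0, hϖ1, hϖ1'⟩ := uniformizer_facts L w hϖ
  obtain ⟨hm1, hℓ⟩ := mstarFn_bounds L w hw he hϖ
  have hvσ : ∀ a : w.1.adicCompletion L, Valued.v ((galAdicCompletionMap (L := L) (IsCMField.complexConj L) hw) a) = Valued.v a := fun a => valued_galAdicCompletionMap (L := L) (IsCMField.complexConj L) hw a
  simp only [pieceTransvMinus, wMatrix]
  exact indicator_profile_level_mul_eq L w hw
    (fun X => NearTransvShell ϖ (dOfPlace L v w % 2) (mstarFn L v w) X ∧ ¬ LabelPlus (galAdicCompletionMap (L := L) (IsCMField.complexConj L) hw) ϖ (dOfPlace L v w) (mstarFn L v w) X)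
    hϖ0 hϖ1 hm1 (fun X D hX hD => and_congr (nearTransvShell_add_iff hϖ0 hϖ1' hℓ le_rfl hX hD) (not_congr (labelPlus_add_iff hvσ hϖ le_rfl _ X hD))) U
    (fun a b => by simpa only [Matrix.smul_apply, Matrix.sub_apply, smul_eq_mul] using hU a b) x

include hw in
/-- **`f_reg(U·x) = f_reg(x)` for `ι_w(U) ≡ 1 (mod ϖ^{m*}·M₃(𝒪_w))`** (`(X + D)² ≡ X² mod ϖ^{m*}`, `1 ≤ m*`). [cite: Kottwitz1986BaseChangeUnits, §3] [cite: BernsteinZelevinsky1976, §1.1] -/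
theorem pieceReg_level_mul_eq (he : v.asIdeal.ramificationIdx' w.1.asIdeal ≠ 1) {ϖ : w.1.adicCompletion L} (hϖ : Valued.v ϖ = WithZero.exp (-1 : ℤ))
    (U : ((UnitaryGroup.cmDatum L 3 (Matrix.of fun i j : Fin 3 => if i.val + j.val + 1 = 3 then (1 : L) else 0)).Local v))
    (hU : ∀ a b, Valued.v ((ϖ ^ (mstarFn L v w))⁻¹ *
      (((((localNonsplitEquiv (IsCMField.complexConj L) (Matrix.of fun i j : Fin 3 => if i.val + j.val + 1 = 3 then (1 : L) else 0) (IsCMField.complexConj_ne_one L) w hw U :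
        ↥(unitaryGroupOfForm (galAdicCompletionMap (L := L) (IsCMField.complexConj L) hw) (placeForm (Matrix.of fun i j : Fin 3 => if i.val + j.val + 1 = 3 then (1 : L) else 0) w.1))) : GL (Fin 3) (w.1.adicCompletion L)) : Matrix (Fin 3) (Fin 3) (w.1.adicCompletion L))) a b - (1 : Matrix (Fin 3) (Fin 3) (w.1.adicCompletion L)) a b)) ≤ 1) (x : ((UnitaryGroup.cmDatum L 3 (Matrix.of fun i j : Fin 3 => if i.val + j.val + 1 = 3 then (1 : L) else 0)).Local v)) :
    pieceReg L v w hw ϖ (U * x) = pieceReg L v w hw ϖ x := by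
  obtain ⟨hϖ0, hϖ1, hϖ1'⟩ := uniformizer_facts L w hϖ
  obtain ⟨hm1, -⟩ := mstarFn_bounds L w hw he hϖ
  simp only [pieceReg, wMatrix]
  exact indicator_profile_level_mul_eq L w hw (fun X => ¬ InLevel ϖ (mstarFn L v w) (X * X)) hϖ0 hϖ1 hm1
    (fun X D hX hD => not_congr (inLevel_mul_self_add_iff hϖ0 hϖ1' le_rfl hX hD)) U
    (fun a b => by simpa only [Matrix.smul_apply, Matrix.sub_apply, smul_eq_mul] using hU a b) x

end Place

/-! ## §3  The heads — `U4_Rows.stub_U4_pieceProps_transvPlus ∕ _transvMinus ∕ _reg` TOKEN FOR TOKEN -/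

/-- **PAYMENT OF `U4_Rows.stub_U4_pieceProps_transvPlus`**: `f_{T+}` is smooth, `K`-supported, `Ad K`-invariant and left-invariant under the level-`m*` congruence set at every
wild ramified non-split place. [cite: Kottwitz1986BaseChangeUnits, §3] [cite: Rogawski1990, §1.6 p. 6] [cite: BernsteinZelevinsky1976, §1.1] -/
theorem piecePropsWild_transvPlus : PiecePropsWild mstarFn (fun _ : Fin 1 => pieceTransvPlus) := by
  intro L _ _ _ v w hw he _h2 ϖ hϖ _ _ _ _ j
  obtain ⟨hsm, hts⟩ := isLocSmooth_pieceTransvPlus L w hw hϖ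
  exact ⟨hsm, hts, fun u hu x => (pieces_conj_eq L w hw hϖ hu x).1, fun U hU x => pieceTransvPlus_level_mul_eq L w hw he hϖ U hU x⟩

/-- **PAYMENT OF `U4_Rows.stub_U4_pieceProps_transvMinus`**: the same for `f_{T−}`. [cite: Kottwitz1986BaseChangeUnits, §3] [cite: Rogawski1990, §1.6 p. 6]
[cite: BernsteinZelevinsky1976, §1.1] -/
theorem piecePropsWild_transvMinus : PiecePropsWild mstarFn (fun _ : Fin 1 => pieceTransvMinus) := by
  intro L _ _ _ v w hw he _h2 ϖ hϖ _ _ _ _ j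
  obtain ⟨hsm, hts⟩ := isLocSmooth_pieceTransvMinus L w hw hϖ
  exact ⟨hsm, hts, fun u hu x => (pieces_conj_eq L w hw hϖ hu x).2.1, fun U hU x => pieceTransvMinus_level_mul_eq L w hw he hϖ U hU x⟩

/-- **PAYMENT OF `U4_Rows.stub_U4_pieceProps_reg`**: the same for `f_reg`. [cite: Kottwitz1986BaseChangeUnits, §3] [cite: Rogawski1990, §1.6 p. 6]
[cite: BernsteinZelevinsky1976, §1.1] -/
theorem piecePropsWild_reg : PiecePropsWild mstarFn (fun _ : Fin 1 => pieceReg) := by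
  intro L _ _ _ v w hw he _h2 ϖ hϖ _ _ _ _ j
  obtain ⟨hsm, hts⟩ := isLocSmooth_pieceReg L w hw hϖ
  exact ⟨hsm, hts, fun u hu x => (pieces_conj_eq L w hw hϖ hu x).2.2, fun U hU x => pieceReg_level_mul_eq L w hw he hϖ U hU x⟩

end Summit.HodgeConjecture.HodgeConjecture.Cruxes.H413.F0P3cDyRamPiecePropsProfiles

end
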